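/-
Copyright (c) 2026 the pub-hodgecm-mathlib formalisation cell (harness21).  Prover seat hodgecm-mathlib-LH4-p09 (g8), req620 Track A «(D-RAM) FOUR-FRAME» squad
(heir LEAD F0P3a-plan (g20) T19-24 «STAGE-1b PRE-SCOPING BY IDLE HANDS: ALLOWED AS SCOPING»; dealer LH4-plan (g12)).  2026-09-04.
-/
import Summits.HodgeConjecture.HodgeConjecture.Theorems.F0P3cDyRamDiagonalOrbitCount           -- ★ (O2c) (LH4-p11 (g2)): brings ★ (O2a) `…DiagonalPairReindex`, ★ engine `…DiagonalOrbitAveraging`, ★ (O2b)-MULT M3 `…OrbitFibreCountMultHeads`, ★ `…StrataDefs`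
import Summits.HodgeConjecture.HodgeConjecture.Theorems.F0P3cDyRamLevelCountDiagonalModel     -- ★ p858764 (this seat): `latticeInLevel_diagonal_mapGL_iff`; brings ★ U2G DEFS `LatticeInLevel`, `LatticeNearTransvShell`
import HarnessLib

/-!
# Crux `H413`, line LH4 «(D-RAM) FOUR-FRAME» road — STAGE-1b SCOPING BRICK «(L-model-A)»: STAGE A (THE ORBIT COUNT (O2a) + (O2c)) WITH A DIAGONAL-INVARIANT LABEL —
# the unit-torus averaging of ★ `F0P3cDyRamDiagonalOrbitCount` for the label-cut fixed-vertex counts of the level ∕ profile censuses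

Cell `hodgecm-mathlib` (D-0151), FLOOR 0, crux item H413 = `stmt-HodgeConjecture-24833`, route of record `HCCMUnconditional`; squad F0∕P3c∕LH4 (req618∕req620).
THEOREMS ONLY (no `def`, no instance, no notation, no `sorry`, default heartbeats); lane `--supports stmt-HodgeConjecture-24833 --as helper` (count-neutral).
Consumers: the STAGE-1b producers of the tier-0 rows `stub_rows_transvPlus ∕ _transvMinus ∕ _regular`.  After ★ p858764 (L-model) every level ∕ profile census of a frame
element is a count of type-`t` vertices of a unit diagonal form `diag(d)` fixed by `T = diag(α, β, 1)` and cut out by a LABEL `Q` built from level tokens of DIAGONAL operators;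
F0P3a-p01 (g35) SIGSHEET-1b draft (F2)∕(F3)∕(F5): these censuses obey the unit laws at shifted exponents and the proof route is the unit route «diagonal model → Stage A (orbit
count) → Stage B (strata)».  This file is STAGE A for any such label.

THE MATHEMATICS ([Kottwitz1986BaseChangeUnits, §1 pp. 240–241]; [Rogawski1990, §4.9 p. 55]; [Serre1980Trees, II §1.1]).  Let `Q` be a label of lattices invariant under every
diagonal translate, `Q(diag(z)·M) ↔ Q(M)` for all `z ∈ (K^×)^N` (§5: every level token `diag(e)·M ⊆ ϖ^ℓ·M` of a diagonal operator is such a label, ★ `latticeInLevel_diagonal_mapGL_iff`,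
and so is any Boolean combination).  (1) Under ★ (O2a)'s bijection `(M₀, b) ↦ diag(ϖ^{b})·M₀` from pairs (`M₀ ∈ 𝓛₀(T)` normalised `T`-stable, `b ∈ ℤ^N`) onto the `T`-fixed
vertices, the label reads `Q(M₀)` (§1); so the label-cut eight-class sum regroups as `Σᶠ_{M₀ ∈ 𝓛₀(T)} F_Q(M₀)` with `F_Q(M) := #{(e, b) : Q(M) ∧ diag(ϖ^{b})·M type-t for diag(c^{e})}`
(§2).  (2) On a unit-torus orbit `𝒯·M₀` the label is constant, so `F_Q = F` on the orbits where `Q(M₀)` holds and `F_Q = 0` on the others: the UNLABELLED per-orbit fibre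
identity (★ (O2b)-MULT M3, `(Σᶠ_{𝒯·M₀} F)·[𝒰 : S_F(M₀)] = 8·[𝒯 : S̃(M₀)]·n_tv(M₀)`) is exactly the hypothesis of the ★ engine `cast_finsum_mem_eq_eight_mul_finsum_mul_stabiliserWeight`
for `F_Q` with multiplicity `[Q]·n_tv` (§3), whence (§4) `↑(Σ_e #{M : type tv for diag(c^{e}), T·M = M, Q M}) = 8 · Σᶠ_{M₀ ∈ 𝓛₀(T), Q M₀} n_tv(M₀) · stabiliserWeight σ M₀`.
* §1 `image_mapGL_diagGLUnits_zpow_normalisedPairs_sep_eq`, `ncard_fixed_vertices_sep_eq_ncard_normalised_pairs` (generic `N`, any label).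
* §2 `sum_ncard_fixed_vertices_sep_eq_finsum_ncard_pairs` — labelled (O2a) (`N = 3`).
* §3 `finsum_mem_sep_eq_finsum_mem_ite`, `sum_ncard_fixed_vertices_sep_eq_eight_mul_finsum_of_fibre_identity` — labelled (O2c) modulo the unlabelled (O2b)-MULT identity on `{Q}`.
* §4 HEAD `sum_ncard_fixed_vertices_sep_eq_eight_mul_finsum_polarisationCount_mul_stabiliserWeight` — labelled Stage A, unconditional (★ M3).
* §5 `latticeInLevel_mapGL_diagGLUnits_iff`, `levels_mapGL_diagGLUnits_iff`, `shell_mapGL_diagGLUnits_iff` (the tokens are invariant labels) and the LEVELS instance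
  `sum_ncard_fixed_vertices_levels_eq_eight_mul_finsum` (`Q M := diag(e₁)·M ⊆ ϖ^a·M ∧ diag(e₂)·M ⊆ ϖ^c·M`, LH4-p06 (g6)'s currency in the model).
HONEST LABEL.  Count-neutral (`--supports`); orbit bookkeeping, nothing printed is asserted; pays NO tier-0 row; STAGE B with a label (the strata tables of the shifted laws) is
NOT here; the census laws stay PROVER TARGETS; `HC_CM` is proved only modulo the 7 printed citations (2 remaining named inputs: hLiu418 = `stmt-HodgeConjecture-24832`, h413 =
`stmt-HodgeConjecture-24833`) until rung 0 closes.

## References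
* [Kottwitz1986BaseChangeUnits] R. E. Kottwitz, *Base change for unit elements of Hecke algebras*, Compositio Math. 60 (1986), §1 pp. 240–241 (orbital integrals of units as lattice
  counts modulo the torus, weighted by stabiliser indices).
* [Rogawski1990] J. D. Rogawski, *Automorphic Representations of Unitary Groups in Three Variables*, Ann. of Math. Stud. 123 (1990), §4.9 Prop. 4.9.1 (a)(b) p. 55.
* [Serre1980Trees] J.-P. Serre, *Trees*, Springer (1980), Ch. II §1.1 (lattices `g·𝒪^N`, lattice classes, the diagonal action).
-/

set_option autoImplicit false

noncomputable section

namespace Summit.HodgeConjecture.HodgeConjecture.Cruxes.H413.F0P3cDyRamDiagonalOrbitCountLabelled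

open Literature.NumberTheory.Automorphic Literature.NumberTheory.Automorphic.HermitianLattice
open Literature.NumberTheory.Automorphic.UnitaryLatticeTree
open Summit.HodgeConjecture.HodgeConjecture.Cruxes.H413.F0P3cDyRamDiagonalTorusDefs
open Summit.HodgeConjecture.HodgeConjecture.Cruxes.H413.F0P3cDyRamDiagonalStrataDefs
open Summit.HodgeConjecture.HodgeConjecture.Cruxes.H413.F0P3cDyRamDiagonalPairReindex
open Summit.HodgeConjecture.HodgeConjecture.Cruxes.H413.F0P3cDyRamDiagonalFixedFinite
open Summit.HodgeConjecture.HodgeConjecture.Cruxes.H413.F0P3cDyRamDiagonalStableLatticesFinite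
open Summit.HodgeConjecture.HodgeConjecture.Cruxes.H413.F0P3cDyRamDiagonalOrbitAveraging
open Summit.HodgeConjecture.HodgeConjecture.Cruxes.H413.F0P3cDyRamFourFrameCensusDefs
open Summit.HodgeConjecture.HodgeConjecture.Cruxes.H413.F0P3cDyRamLevelCountDiagonalModel
open scoped Valued WithZero Matrix MatrixGroups

/-! ## §1  The labelled re-indexing `(M₀, b) ↦ diag(ϖ^{b})·M₀` (generic `N`, one form, any type, any diagonal-invariant label) -/

section Reindex

variable {K : Type*} [Field K] [Valued K ℤᵐ⁰] {N : ℕ}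

/-- **THE IMAGE of `(M₀, b) ↦ diag(ϖ^{b})·M₀` on the LABELLED pairs `{(M₀, b) : M₀ ∈ 𝓛₀(T), Q M₀, diag(ϖ^{b})·M₀ a type-t vertex of diag(D)}` IS the labelled fixed-vertex set
`{M : type-t vertex of diag(D), T·M = M, Q M}`**, for a label `Q` invariant under diagonal translates (★ `image_mapGL_diagGLUnits_zpow_normalisedPairs_eq` + the invariance).
[cite: Kottwitz1986BaseChangeUnits, §1 pp. 240–241] [cite: Serre1980Trees, II §1.1] -/
theorem image_mapGL_diagGLUnits_zpow_normalisedPairs_sep_eq (σ : K →+* K) {ϖ : K} (hϖ : Valued.v ϖ = WithZero.exp (-1 : ℤ)) (ϖu : Kˣ) (hϖu : (ϖu : K) = ϖ)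
    (D : Fin N → K) (t : ℕ) {s : Fin N → K} (T : GL (Fin N) K) (hT : (T : Matrix (Fin N) (Fin N) K) = Matrix.diagonal s)
    (Q : Submodule 𝒪[K] (Fin N → K) → Prop) (hQ : ∀ (z : Fin N → Kˣ) (M : Submodule 𝒪[K] (Fin N → K)), Q (mapGL (diagGLUnits z) M) ↔ Q M) :
    (fun p : Submodule 𝒪[K] (Fin N → K) × (Fin N → ℤ) => mapGL (diagGLUnits fun i => ϖu ^ p.2 i) p.1) ''
        {p | p.1 ∈ normalisedStableLattices T ∧ Q p.1 ∧ IsVertexLattice σ ϖ (Matrix.diagonal D) t (mapGL (diagGLUnits fun i => ϖu ^ p.2 i) p.1)} =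
      {M : Submodule 𝒪[K] (Fin N → K) | IsVertexLattice σ ϖ (Matrix.diagonal D) t M ∧ mapGL T M = M ∧ Q M} := by
  have himg := image_mapGL_diagGLUnits_zpow_normalisedPairs_eq σ hϖ ϖu hϖu D t T hT
  ext M
  constructor
  · rintro ⟨p, ⟨hp1, hQp, hV⟩, rfl⟩
    have hmem : mapGL (diagGLUnits fun i => ϖu ^ p.2 i) p.1 ∈
        (fun p : Submodule 𝒪[K] (Fin N → K) × (Fin N → ℤ) => mapGL (diagGLUnits fun i => ϖu ^ p.2 i) p.1) ''
          {p | p.1 ∈ normalisedStableLattices T ∧ IsVertexLattice σ ϖ (Matrix.diagonal D) t (mapGL (diagGLUnits fun i => ϖu ^ p.2 i) p.1)} :=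
      ⟨p, ⟨hp1, hV⟩, rfl⟩
    rw [himg] at hmem
    exact ⟨hmem.1, hmem.2, (hQ _ _).2 hQp⟩
  · rintro ⟨hV, hTM, hQM⟩
    have hmem : M ∈ (fun p : Submodule 𝒪[K] (Fin N → K) × (Fin N → ℤ) => mapGL (diagGLUnits fun i => ϖu ^ p.2 i) p.1) ''
        {p | p.1 ∈ normalisedStableLattices T ∧ IsVertexLattice σ ϖ (Matrix.diagonal D) t (mapGL (diagGLUnits fun i => ϖu ^ p.2 i) p.1)} := by
      rw [himg]
      exact ⟨hV, hTM⟩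
    obtain ⟨p, ⟨hp1, hVp⟩, hp⟩ := hmem
    have hp' : mapGL (diagGLUnits fun i => ϖu ^ p.2 i) p.1 = M := hp
    refine ⟨p, ⟨hp1, ?_, hVp⟩, hp⟩
    rw [← hQ (fun i => ϖu ^ p.2 i), hp']
    exact hQM

/-- **LABELLED «PAIRS RE-INDEXED BY NORMALISATION», ONE FORM**: `#{M : type t for diag(D), T·M = M, Q M} = #{(M₀, b) : M₀ ∈ 𝓛₀(T), Q M₀, diag(ϖ^{b})·M₀ type t for diag(D)}`
(★ `injOn_mapGL_diagGLUnits_zpow` + §1 image; `Set.ncard`, both `0` if infinite). [cite: Kottwitz1986BaseChangeUnits, §1 pp. 240–241] [cite: Serre1980Trees, II §1.1] -/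
theorem ncard_fixed_vertices_sep_eq_ncard_normalised_pairs (σ : K →+* K) {ϖ : K} (hϖ : Valued.v ϖ = WithZero.exp (-1 : ℤ)) (ϖu : Kˣ) (hϖu : (ϖu : K) = ϖ)
    (D : Fin N → K) (t : ℕ) {s : Fin N → K} (T : GL (Fin N) K) (hT : (T : Matrix (Fin N) (Fin N) K) = Matrix.diagonal s)
    (Q : Submodule 𝒪[K] (Fin N → K) → Prop) (hQ : ∀ (z : Fin N → Kˣ) (M : Submodule 𝒪[K] (Fin N → K)), Q (mapGL (diagGLUnits z) M) ↔ Q M) :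
    {M : Submodule 𝒪[K] (Fin N → K) | IsVertexLattice σ ϖ (Matrix.diagonal D) t M ∧ mapGL T M = M ∧ Q M}.ncard =
      {p : Submodule 𝒪[K] (Fin N → K) × (Fin N → ℤ) | p.1 ∈ normalisedStableLattices T ∧ Q p.1 ∧
        IsVertexLattice σ ϖ (Matrix.diagonal D) t (mapGL (diagGLUnits fun i => ϖu ^ p.2 i) p.1)}.ncard := by
  rw [← image_mapGL_diagGLUnits_zpow_normalisedPairs_sep_eq σ hϖ ϖu hϖu D t T hT Q hQ]
  refine Set.InjOn.ncard_image ((injOn_mapGL_diagGLUnits_zpow hϖ ϖu hϖu).mono fun p hp => ?_)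
  obtain ⟨⟨hl, -, hn⟩, -⟩ := hp
  exact ⟨hl, hn⟩

end Reindex

/-! ## §2  Labelled (O2a): the label-cut eight-class sum re-indexed over `𝓛₀(T)` (`N = 3`) -/

section StageA

variable {K : Type*} [Field K] [Valued K ℤᵐ⁰]

/-- **LABELLED (O2a).**  Finite residue field, valuation-preserving `σ`, uniformiser `ϖ = ↑ϖu`, a unit `c`, a regular unit diagonal `T = diag(s)`, a type `t`, and a label `Q`
invariant under diagonal translates: `Σ_{e : Fin 3 → Bool} #{M : type t for diag(c^{e}), T·M = M, Q M} = Σᶠ_{M₀ ∈ 𝓛₀(T)} #{(e, b) : Q M₀ ∧ diag(ϖ^{b})·M₀ type t for diag(c^{e})}`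
(★ (O2a)'s regrouping with the label riding along §1; the right-hand fibre is EMPTY where `Q M₀` fails). [cite: Kottwitz1986BaseChangeUnits, §1 pp. 240–241] [cite: Serre1980Trees, II §1.1] -/
theorem sum_ncard_fixed_vertices_sep_eq_finsum_ncard_pairs [Finite 𝓀[K]] {σ : K →+* K}
    (hvσ : ∀ a, Valued.v (σ a) = Valued.v a) {ϖ : K} (hϖ : Valued.v ϖ = WithZero.exp (-1 : ℤ)) (ϖu : Kˣ) (hϖu : (ϖu : K) = ϖ)
    {c : K} (hc : Valued.v c = 1) {s : Fin 3 → K} (hs : ∀ i, Valued.v (s i) = 1) (hinj : Function.Injective s)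
    (T : GL (Fin 3) K) (hT : (T : Matrix (Fin 3) (Fin 3) K) = Matrix.diagonal s) (t : ℕ)
    (Q : Submodule 𝒪[K] (Fin 3 → K) → Prop) (hQ : ∀ (z : Fin 3 → Kˣ) (M : Submodule 𝒪[K] (Fin 3 → K)), Q (mapGL (diagGLUnits z) M) ↔ Q M) :
    ∑ e : Fin 3 → Bool, {M : Submodule 𝒪[K] (Fin 3 → K) |
        IsVertexLattice σ ϖ (Matrix.diagonal fun i => if e i then c else (1 : K)) t M ∧ mapGL T M = M ∧ Q M}.ncard =
      ∑ᶠ M₀ ∈ normalisedStableLattices T, {p : (Fin 3 → Bool) × (Fin 3 → ℤ) | Q M₀ ∧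
        IsVertexLattice σ ϖ (Matrix.diagonal fun i => if p.1 i then c else (1 : K)) t (mapGL (diagGLUnits fun i => ϖu ^ p.2 i) M₀)}.ncard := by
  have hd : ∀ (e : Fin 3 → Bool) (i : Fin 3), Valued.v (if e i then c else (1 : K)) = 1 := by
    intro e i
    split_ifs
    · exact hc
    · exact map_one _
  have hs' : ∀ i, Valued.v (s i) ≤ 1 := fun i => (hs i).le
  have h𝓛 : (normalisedStableLattices T).Finite :=
    finite_setOf_normalised_diagonal_fixed_latt hϖ s hs (fun i j hij => hinj.ne hij) T hT
  -- the labelled pair sets are finite (subsets of ★ (O2a)'s pair sets), hence so is every fibre over `M₀ ∈ 𝓛₀(T)`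
  have hSR : ∀ e : Fin 3 → Bool, {p : Submodule 𝒪[K] (Fin 3 → K) × (Fin 3 → ℤ) | p.1 ∈ normalisedStableLattices T ∧ Q p.1 ∧
      IsVertexLattice σ ϖ (Matrix.diagonal fun i => if e i then c else (1 : K)) t (mapGL (diagGLUnits fun i => ϖu ^ p.2 i) p.1)}.Finite := fun e =>
    (finite_normalisedPairs_of_finite_fixed_vertices σ hϖ ϖu hϖu _ t T hT
      (finite_setOf_isVertexLattice_mapGL_diagonal_eq hvσ hϖ (hd e) s hs' hinj T hT t)).subset fun p hp => ⟨hp.1, hp.2.2⟩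
  have hA : ∀ (e : Fin 3 → Bool), ∀ M₀ ∈ normalisedStableLattices T, {b : Fin 3 → ℤ | Q M₀ ∧
      IsVertexLattice σ ϖ (Matrix.diagonal fun i => if e i then c else (1 : K)) t (mapGL (diagGLUnits fun i => ϖu ^ b i) M₀)}.Finite := fun e M₀ hM₀ =>
    ((hSR e).preimage (Prod.mk_right_injective M₀).injOn).subset fun b hb => ⟨hM₀, hb⟩
  -- §1 class by class, then the fibrewise count over `M₀ ∈ 𝓛₀(T)`
  have h1 : ∀ e : Fin 3 → Bool, {M : Submodule 𝒪[K] (Fin 3 → K) |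
        IsVertexLattice σ ϖ (Matrix.diagonal fun i => if e i then c else (1 : K)) t M ∧ mapGL T M = M ∧ Q M}.ncard =
      ∑ᶠ M₀ ∈ normalisedStableLattices T, {b : Fin 3 → ℤ | Q M₀ ∧
        IsVertexLattice σ ϖ (Matrix.diagonal fun i => if e i then c else (1 : K)) t (mapGL (diagGLUnits fun i => ϖu ^ b i) M₀)}.ncard := fun e => by
    rw [ncard_fixed_vertices_sep_eq_ncard_normalised_pairs σ hϖ ϖu hϖu _ t T hT Q hQ]
    exact ncard_setOf_mem_and_mem_eq_finsum_mem h𝓛 (fun M₀ => {b : Fin 3 → ℤ | Q M₀ ∧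
      IsVertexLattice σ ϖ (Matrix.diagonal fun i => if e i then c else (1 : K)) t (mapGL (diagGLUnits fun i => ϖu ^ b i) M₀)}) (hA e)
  -- the fibrewise count over the eight classes
  have h2 : ∀ M₀ ∈ normalisedStableLattices T, ∑ e : Fin 3 → Bool, {b : Fin 3 → ℤ | Q M₀ ∧
        IsVertexLattice σ ϖ (Matrix.diagonal fun i => if e i then c else (1 : K)) t (mapGL (diagGLUnits fun i => ϖu ^ b i) M₀)}.ncard =
      {p : (Fin 3 → Bool) × (Fin 3 → ℤ) | Q M₀ ∧
        IsVertexLattice σ ϖ (Matrix.diagonal fun i => if p.1 i then c else (1 : K)) t (mapGL (diagGLUnits fun i => ϖu ^ p.2 i) M₀)}.ncard := fun M₀ hM₀ => by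
    have h := ncard_setOf_mem_eq_sum (fun e : Fin 3 → Bool => {b : Fin 3 → ℤ | Q M₀ ∧
      IsVertexLattice σ ϖ (Matrix.diagonal fun i => if e i then c else (1 : K)) t (mapGL (diagGLUnits fun i => ϖu ^ b i) M₀)}) fun e => hA e M₀ hM₀
    rw [← h]
    congr 1
  -- regroup: swap the finite sum over `e` with the finite sum over `𝓛₀(T)`
  calc ∑ e : Fin 3 → Bool, {M : Submodule 𝒪[K] (Fin 3 → K) |
          IsVertexLattice σ ϖ (Matrix.diagonal fun i => if e i then c else (1 : K)) t M ∧ mapGL T M = M ∧ Q M}.ncard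
      = ∑ e : Fin 3 → Bool, ∑ M₀ ∈ h𝓛.toFinset, {b : Fin 3 → ℤ | Q M₀ ∧
          IsVertexLattice σ ϖ (Matrix.diagonal fun i => if e i then c else (1 : K)) t (mapGL (diagGLUnits fun i => ϖu ^ b i) M₀)}.ncard :=
        Finset.sum_congr rfl fun e _ => by rw [h1 e, finsum_mem_eq_finite_toFinset_sum _ h𝓛]
    _ = ∑ M₀ ∈ h𝓛.toFinset, ∑ e : Fin 3 → Bool, {b : Fin 3 → ℤ | Q M₀ ∧
          IsVertexLattice σ ϖ (Matrix.diagonal fun i => if e i then c else (1 : K)) t (mapGL (diagGLUnits fun i => ϖu ^ b i) M₀)}.ncard := Finset.sum_comm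
    _ = ∑ M₀ ∈ h𝓛.toFinset, {p : (Fin 3 → Bool) × (Fin 3 → ℤ) | Q M₀ ∧
          IsVertexLattice σ ϖ (Matrix.diagonal fun i => if p.1 i then c else (1 : K)) t (mapGL (diagGLUnits fun i => ϖu ^ p.2 i) M₀)}.ncard :=
        Finset.sum_congr rfl fun M₀ hM₀ => h2 M₀ (h𝓛.mem_toFinset.1 hM₀)
    _ = ∑ᶠ M₀ ∈ normalisedStableLattices T, {p : (Fin 3 → Bool) × (Fin 3 → ℤ) | Q M₀ ∧
          IsVertexLattice σ ϖ (Matrix.diagonal fun i => if p.1 i then c else (1 : K)) t (mapGL (diagGLUnits fun i => ϖu ^ p.2 i) M₀)}.ncard :=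
        (finsum_mem_eq_finite_toFinset_sum _ h𝓛).symm

/-! ## §3  Labelled (O2c) modulo the unlabelled per-orbit fibre identity on the orbits where the label holds -/

/-- A finite sum over the members of `A` satisfying `Q` is the sum over `A` of the `Q`-indicator-weighted terms. [cite: Serre1980Trees, II §1.1] -/
theorem finsum_mem_sep_eq_finsum_mem_ite {α : Type*} {A : Set α} (hA : A.Finite) (Q : α → Prop) [DecidablePred Q] (g : α → ℚ) :
    ∑ᶠ a ∈ {a | a ∈ A ∧ Q a}, g a = ∑ᶠ a ∈ A, (if Q a then g a else 0) := by
  have hAQ : {a | a ∈ A ∧ Q a}.Finite := hA.subset fun a ha => ha.1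
  rw [finsum_mem_eq_finite_toFinset_sum _ hAQ, finsum_mem_eq_finite_toFinset_sum _ hA, ← Finset.sum_filter]
  congr 1
  ext a
  simp only [Set.Finite.mem_toFinset, Set.mem_setOf_eq, Finset.mem_filter]

/-- **LABELLED (O2c) MODULO THE UNLABELLED (O2b) WITH MULTIPLICITY ON `{Q}`.**  Same data as §2 and ANY multiplicity `m`: if the per-orbit fibre identity
`(Σᶠ_{M ∈ 𝒯·M₀} #{(e, b) : diag(ϖ^{b})·M type t for diag(c^{e})})·[𝒰 : S_F(M₀)] = 8·[𝒯 : S̃(M₀)]·m(M₀)` holds at every `M₀ ∈ 𝓛₀(T)` WITH `Q M₀`, then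
`↑(Σ_e #{M : type t for diag(c^{e}), T·M = M, Q M}) = 8 · Σᶠ_{M₀ ∈ 𝓛₀(T), Q M₀} m(M₀)·stabiliserWeight σ M₀` — the label is constant on `𝒯·M₀` (invariance), so the labelled
fibre count `F_Q` equals the unlabelled one on the `Q`-orbits and vanishes on the others, and the ★ engine `cast_finsum_mem_eq_eight_mul_finsum_mul_stabiliserWeight` applies to
`F_Q` with multiplicity `[Q]·m`. [cite: Kottwitz1986BaseChangeUnits, §1 pp. 240–241] [cite: Rogawski1990, §4.9 Prop. 4.9.1 (a) p. 55] -/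
theorem sum_ncard_fixed_vertices_sep_eq_eight_mul_finsum_of_fibre_identity [Finite 𝓀[K]] {σ : K →+* K}
    (hvσ : ∀ a, Valued.v (σ a) = Valued.v a) {ϖ : K} (hϖ : Valued.v ϖ = WithZero.exp (-1 : ℤ)) (ϖu : Kˣ) (hϖu : (ϖu : K) = ϖ)
    {c : K} (hc : Valued.v c = 1) {s : Fin 3 → K} (hs : ∀ i, Valued.v (s i) = 1) (hreg : ∀ i j, i ≠ j → s i ≠ s j)
    (T : GL (Fin 3) K) (hT : (T : Matrix (Fin 3) (Fin 3) K) = Matrix.diagonal s) (t : ℕ) (m : Submodule 𝒪[K] (Fin 3 → K) → ℕ)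
    (Q : Submodule 𝒪[K] (Fin 3 → K) → Prop) (hQ : ∀ (z : Fin 3 → Kˣ) (M : Submodule 𝒪[K] (Fin 3 → K)), Q (mapGL (diagGLUnits z) M) ↔ Q M)
    (hO2b : ∀ M₀ ∈ normalisedStableLattices T, Q M₀ →
      (∑ᶠ M ∈ {M : Submodule 𝒪[K] (Fin 3 → K) | ∃ u ∈ unitTorus K 3, M = mapGL (diagGLUnits u) M₀},
          ({p : (Fin 3 → Bool) × (Fin 3 → ℤ) |
            IsVertexLattice σ ϖ (Matrix.diagonal fun i => if p.1 i then c else (1 : K)) t (mapGL (diagGLUnits fun i => ϖu ^ p.2 i) M)} : Set _).ncard)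
        * (fixedUnitStabilizer σ M₀).relIndex (fixedUnitTorus σ 3)
        = 8 * (unitStabilizer M₀).relIndex (unitTorus K 3) * m M₀) :
    (((∑ e : Fin 3 → Bool, {M : Submodule 𝒪[K] (Fin 3 → K) |
        IsVertexLattice σ ϖ (Matrix.diagonal fun i => if e i then c else (1 : K)) t M ∧ mapGL T M = M ∧ Q M}.ncard : ℕ) : ℚ)) =
      8 * ∑ᶠ M₀ ∈ {M | M ∈ normalisedStableLattices T ∧ Q M}, (m M₀ : ℚ) * stabiliserWeight σ M₀ := by
  classical
  have hinj : Function.Injective s := fun i j hij => by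
    by_contra h
    exact hreg i j h hij
  have h𝓛 : (normalisedStableLattices T).Finite := finite_setOf_normalised_diagonal_fixed_latt hϖ s hs hreg T hT
  rw [sum_ncard_fixed_vertices_sep_eq_finsum_ncard_pairs hvσ hϖ ϖu hϖu hc hs hinj T hT t Q hQ]
  -- the engine, fed with the labelled fibre count and the multiplicity `[Q]·m`
  have key := cast_finsum_mem_eq_eight_mul_finsum_mul_stabiliserWeight hϖ hs hreg T hT σ
    (fun M => ({p : (Fin 3 → Bool) × (Fin 3 → ℤ) | Q M ∧
      IsVertexLattice σ ϖ (Matrix.diagonal fun i => if p.1 i then c else (1 : K)) t (mapGL (diagGLUnits fun i => ϖu ^ p.2 i) M)} : Set _).ncard)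
    (fun M₀ => if Q M₀ then m M₀ else 0) fun M₀ hM₀ => ?_
  · rw [key, finsum_mem_sep_eq_finsum_mem_ite h𝓛 Q]
    congr 1
    refine finsum_mem_congr rfl fun M₀ _ => ?_
    split_ifs <;> simp
  -- the per-orbit hypothesis: the label is constant on the unit-torus orbit of `M₀`
  · by_cases hQ₀ : Q M₀
    · rw [if_pos hQ₀, ← hO2b M₀ hM₀ hQ₀]
      congr 1
      refine finsum_mem_congr rfl fun M hM => ?_
      obtain ⟨u, -, rfl⟩ := hM
      have hQM : Q (mapGL (diagGLUnits u) M₀) := (hQ u M₀).2 hQ₀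
      congr 1
      ext p
      simp only [Set.mem_setOf_eq, hQM, true_and]
    · rw [if_neg hQ₀, mul_zero]
      have hzero : ∀ M ∈ {M : Submodule 𝒪[K] (Fin 3 → K) | ∃ u ∈ unitTorus K 3, M = mapGL (diagGLUnits u) M₀},
          ({p : (Fin 3 → Bool) × (Fin 3 → ℤ) | Q M ∧
            IsVertexLattice σ ϖ (Matrix.diagonal fun i => if p.1 i then c else (1 : K)) t (mapGL (diagGLUnits fun i => ϖu ^ p.2 i) M)} : Set _).ncard = 0 := by
        rintro M ⟨u, -, rfl⟩
        have hQM : ¬ Q (mapGL (diagGLUnits u) M₀) := fun h => hQ₀ ((hQ u M₀).1 h)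
        have hempty : ({p : (Fin 3 → Bool) × (Fin 3 → ℤ) | Q (mapGL (diagGLUnits u) M₀) ∧
            IsVertexLattice σ ϖ (Matrix.diagonal fun i => if p.1 i then c else (1 : K)) t
              (mapGL (diagGLUnits fun i => ϖu ^ p.2 i) (mapGL (diagGLUnits u) M₀))} : Set _) = ∅ :=
          Set.eq_empty_of_forall_notMem fun p hp => hQM hp.1
        rw [hempty, Set.ncard_empty]
      rw [finsum_mem_congr rfl hzero]
      simp only [finsum_zero, zero_mul]

/-! ## §4  HEAD — labelled Stage A, unconditional: the (O2b) identity with multiplicity is ★ M3 -/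

/-- **LABELLED STAGE A — (O2c) WITH MULTIPLICITY AND A DIAGONAL-INVARIANT LABEL.**  For `T = diag(s)` (`s` pairwise-distinct units, finite residue field), an involution `σ`
with `v ∘ σ = v`, a uniformiser `ϖ = ↑ϖu`, a `σ`-fixed NON-NORM unit `c` with the index-two dichotomy, a vertex type `tv` and a label `Q` with `Q(diag(z)·M) ↔ Q(M)`:
`↑(Σ_{e : Fin 3 → Bool} #{M : M type-tv for diag(c^{e}), T·M = M, Q M}) = 8 · Σᶠ_{M₀ ∈ 𝓛₀(T), Q M₀} polarisationCount σ ϖ tv M₀ · stabiliserWeight σ M₀` over `ℚ`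
(§3 fed with ★ (O2b)-MULT M3 `finsum_ncard_fibre_mul_relIndex_eq_mul_ncard_cosets_of_mem_normalisedStableLattices`; `Q ≡ True` is ★ (O2c)).  Stage A of every level ∕ profile law in
the unimodular diagonal model. [cite: Kottwitz1986BaseChangeUnits, §1 pp. 240–241] [cite: Rogawski1990, §4.9 Prop. 4.9.1 (a) p. 55] -/
theorem sum_ncard_fixed_vertices_sep_eq_eight_mul_finsum_polarisationCount_mul_stabiliserWeight [Finite 𝓀[K]] {σ : K →+* K} (hσ : ∀ x, σ (σ x) = x)
    (hvσ : ∀ a, Valued.v (σ a) = Valued.v a) {ϖ : K} (hϖ : Valued.v ϖ = WithZero.exp (-1 : ℤ)) (ϖu : Kˣ) (hϖu : (ϖu : K) = ϖ)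
    {c : K} (hσc : σ c = c) (hcv : Valued.v c = 1) (hc : ¬ ∃ z : K, z * σ z = c)
    (hdich : ∀ x : K, σ x = x → x ≠ 0 → (∃ z : K, z * σ z = x) ∨ ∃ z : K, z * σ z = c * x)
    {s : Fin 3 → K} (hs : ∀ i, Valued.v (s i) = 1) (hreg : ∀ i j, i ≠ j → s i ≠ s j)
    (T : GL (Fin 3) K) (hT : (T : Matrix (Fin 3) (Fin 3) K) = Matrix.diagonal s) (tv : ℕ)
    (Q : Submodule 𝒪[K] (Fin 3 → K) → Prop) (hQ : ∀ (z : Fin 3 → Kˣ) (M : Submodule 𝒪[K] (Fin 3 → K)), Q (mapGL (diagGLUnits z) M) ↔ Q M) :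
    (((∑ e : Fin 3 → Bool, {M : Submodule 𝒪[K] (Fin 3 → K) |
        IsVertexLattice σ ϖ (Matrix.diagonal fun i => if e i then c else (1 : K)) tv M ∧ mapGL T M = M ∧ Q M}.ncard : ℕ) : ℚ)) =
      8 * ∑ᶠ M₀ ∈ {M | M ∈ normalisedStableLattices T ∧ Q M}, (polarisationCount σ ϖ tv M₀ : ℚ) * stabiliserWeight σ M₀ :=
  sum_ncard_fixed_vertices_sep_eq_eight_mul_finsum_of_fibre_identity hvσ hϖ ϖu hϖu hcv hs hreg T hT tv (polarisationCount σ ϖ tv) Q hQ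
    fun _ hM₀ _ => F0P3cDyRamDiagonalOrbitFibreCountMultHeads.finsum_ncard_fibre_mul_relIndex_eq_mul_ncard_cosets_of_mem_normalisedStableLattices
      hσ hvσ hϖ ϖu hϖu hσc hcv hc hdich hs hreg T hT hM₀ tv

/-! ## §5  The level tokens of diagonal operators are invariant labels; the LEVELS instance -/

/-- **A LEVEL TOKEN OF A DIAGONAL OPERATOR IS A DIAGONAL-INVARIANT LABEL**: `diag(e)·(diag(z)·M) ⊆ ϖ^ℓ·(diag(z)·M) ↔ diag(e)·M ⊆ ϖ^ℓ·M` for every `z ∈ (K^×)³`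
(★ `latticeInLevel_diagonal_mapGL_iff` at `P = diagGLUnits z`). [cite: Kottwitz1986BaseChangeUnits, §1 pp. 240–241] -/
theorem latticeInLevel_mapGL_diagGLUnits_iff (z : Fin 3 → Kˣ) (ϖ : K) (ℓ : ℕ) (e : Fin 3 → K) (M : Submodule 𝒪[K] (Fin 3 → K)) :
    LatticeInLevel ϖ ℓ (Matrix.diagonal e) (mapGL (diagGLUnits z) M) ↔ LatticeInLevel ϖ ℓ (Matrix.diagonal e) M :=
  latticeInLevel_diagonal_mapGL_iff (coe_diagGLUnits z) ϖ ℓ e M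

/-- The levels label `diag(e₁)·M ⊆ ϖ^a·M ∧ diag(e₂)·M ⊆ ϖ^c·M` (LH4-p06 (g6)'s `#levels_{a,c}` currency in the model, ★ p858764) is diagonal-invariant.
[cite: Kottwitz1986BaseChangeUnits, §1 pp. 240–241] -/
theorem levels_mapGL_diagGLUnits_iff (ϖ : K) (a c : ℕ) (e₁ e₂ : Fin 3 → K) (z : Fin 3 → Kˣ) (M : Submodule 𝒪[K] (Fin 3 → K)) :
    (LatticeInLevel ϖ a (Matrix.diagonal e₁) (mapGL (diagGLUnits z) M) ∧ LatticeInLevel ϖ c (Matrix.diagonal e₂) (mapGL (diagGLUnits z) M)) ↔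
      (LatticeInLevel ϖ a (Matrix.diagonal e₁) M ∧ LatticeInLevel ϖ c (Matrix.diagonal e₂) M) := by
  rw [latticeInLevel_mapGL_diagGLUnits_iff, latticeInLevel_mapGL_diagGLUnits_iff]

/-- The unlabelled SHELL label `diag(e₁)·M ⊆ ϖ^ℓM ∧ ¬ diag(e₁)·M ⊆ ϖ^{ℓ+1}M ∧ diag(e₂)·M ⊆ ϖ^mM` is diagonal-invariant. [cite: Kottwitz1986BaseChangeUnits, §1 pp. 240–241] -/
theorem shell_mapGL_diagGLUnits_iff (ϖ : K) (ℓ m : ℕ) (e₁ e₂ : Fin 3 → K) (z : Fin 3 → Kˣ) (M : Submodule 𝒪[K] (Fin 3 → K)) :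
    (LatticeInLevel ϖ ℓ (Matrix.diagonal e₁) (mapGL (diagGLUnits z) M) ∧ ¬ LatticeInLevel ϖ (ℓ + 1) (Matrix.diagonal e₁) (mapGL (diagGLUnits z) M) ∧
        LatticeInLevel ϖ m (Matrix.diagonal e₂) (mapGL (diagGLUnits z) M)) ↔
      (LatticeInLevel ϖ ℓ (Matrix.diagonal e₁) M ∧ ¬ LatticeInLevel ϖ (ℓ + 1) (Matrix.diagonal e₁) M ∧ LatticeInLevel ϖ m (Matrix.diagonal e₂) M) := by
  rw [latticeInLevel_mapGL_diagGLUnits_iff, latticeInLevel_mapGL_diagGLUnits_iff, latticeInLevel_mapGL_diagGLUnits_iff]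

/-- **STAGE A OF THE LEVELS CENSUS** (the instance the STAGE-1b level laws consume; ★ p858764 `exists_diagonal_model_levelCounts` (i) put the frame census in this
currency with `T = diag(α, β, 1)`, `e₁ = (α−1, β−1, 0)`, `e₂ = ((α−1)², (β−1)², 0)`):
`↑(Σ_e #{M : type-tv for diag(c^{e}), T·M = M, diag(e₁)M ⊆ ϖ^aM, diag(e₂)M ⊆ ϖ^cM}) = 8 · Σᶠ_{M₀ ∈ 𝓛₀(T), diag(e₁)M₀ ⊆ ϖ^aM₀ ∧ diag(e₂)M₀ ⊆ ϖ^cM₀} n_tv(M₀) · stabiliserWeight σ M₀`.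
[cite: Kottwitz1986BaseChangeUnits, §1 pp. 240–241] [cite: Rogawski1990, §4.9 Prop. 4.9.1 (a)(b) p. 55] -/
theorem sum_ncard_fixed_vertices_levels_eq_eight_mul_finsum [Finite 𝓀[K]] {σ : K →+* K} (hσ : ∀ x, σ (σ x) = x)
    (hvσ : ∀ a, Valued.v (σ a) = Valued.v a) {ϖ : K} (hϖ : Valued.v ϖ = WithZero.exp (-1 : ℤ)) (ϖu : Kˣ) (hϖu : (ϖu : K) = ϖ)
    {c : K} (hσc : σ c = c) (hcv : Valued.v c = 1) (hc : ¬ ∃ z : K, z * σ z = c)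
    (hdich : ∀ x : K, σ x = x → x ≠ 0 → (∃ z : K, z * σ z = x) ∨ ∃ z : K, z * σ z = c * x)
    {s : Fin 3 → K} (hs : ∀ i, Valued.v (s i) = 1) (hreg : ∀ i j, i ≠ j → s i ≠ s j)
    (T : GL (Fin 3) K) (hT : (T : Matrix (Fin 3) (Fin 3) K) = Matrix.diagonal s) (tv a c' : ℕ) (e₁ e₂ : Fin 3 → K) :
    (((∑ e : Fin 3 → Bool, {M : Submodule 𝒪[K] (Fin 3 → K) |
        IsVertexLattice σ ϖ (Matrix.diagonal fun i => if e i then c else (1 : K)) tv M ∧ mapGL T M = M ∧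
          (LatticeInLevel ϖ a (Matrix.diagonal e₁) M ∧ LatticeInLevel ϖ c' (Matrix.diagonal e₂) M)}.ncard : ℕ) : ℚ)) =
      8 * ∑ᶠ M₀ ∈ {M | M ∈ normalisedStableLattices T ∧ (LatticeInLevel ϖ a (Matrix.diagonal e₁) M ∧ LatticeInLevel ϖ c' (Matrix.diagonal e₂) M)},
        (polarisationCount σ ϖ tv M₀ : ℚ) * stabiliserWeight σ M₀ :=
  sum_ncard_fixed_vertices_sep_eq_eight_mul_finsum_polarisationCount_mul_stabiliserWeight hσ hvσ hϖ ϖu hϖu hσc hcv hc hdich hs hreg T hT tv _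
    fun z M => levels_mapGL_diagGLUnits_iff ϖ a c' e₁ e₂ z M

end StageA

end Summit.HodgeConjecture.HodgeConjecture.Cruxes.H413.F0P3cDyRamDiagonalOrbitCountLabelled

end
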